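import Literature.Probability.Percolation.CardyFormula
import Literature.Probability.Percolation.BoxCrossingProofs
import Literature.Probability.LatticeModels.DirichletGreenFunction
import HarnessLib

/-!
# Vocabulary of the line `excursion-kernel-covariance` for crux `RectilinearCardy`
# (stmt-CriticalPhenomena-5660, route `CardyBoundaryCoulombGas`, sub-problem `CardyFormulaZ2`)

This is the DEFINITIONS MODULE of the line (lead `prover-line-stmt-CriticalPhenomena-5660-0`,
2026-08-16): the objects that the line skeleton `Cruxes/RectilinearCardy/Lines/excursion_kernel_covariance.lean`
posits, over tree declarations only, so that the landed stub files
(`Theorems/CardyBoundaryCoulombGasRectilinearCardy*.lean`, which had to inline them) and the conditional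
assembly `rectilinearCardy_of_cubeRootLaw_of_kernelScalingLimit` can refer to them BY NAME. Nothing is
asserted here beyond elementary bookkeeping lemmas (monotonicity of the two tail functions).

The line ("corners ride on the random walk"): telescope the crossing event of a conformal rectangle
`R = (Ω; a, b, c, d)` along the arc `(b → c → d)`; `tailCrossingProb R δ s` = `Q_δ(s)` = the
`P_{1/2}`-probability that the discrete arc `(ab)_δ` is joined inside `Ω_δ` to the discretisation of the
tail sub-arc `∂Ω[s, d] = boundary '' [s, mark 3]` (`tailArc`), so that `Q_δ(mark 2)` is the crux's own
`bondDomainCrossingProb R δ` (`tailCrossingProb_mark_two`) and `Q_δ` is the tail distribution function of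
the `d`-most boundary vertex joined to `(ab)_δ`. The random-walk prediction `kernelTailFraction R δ s` =
`ν_δ(s)` is the self-normalised mass of the tail arc under the CUBE-ROOT WEIGHT
`cubeRootWeight R δ v = (K v a_δ · K v b_δ · K v d_δ)^{1/3}`, `K = excursionKernel R δ` = the Dirichlet
Green function of simple random walk killed on leaving `Ω_δ` (tree `dirichletGreen` on `domainFinset`),
`a_δ, b_δ, d_δ = markRep R δ 0/1/3` nearest mesh-boundary vertices to the marks — the `(1,1,1;3)` member
of the route's boundary Coulomb gas read intrinsically (charge vector `(1,1,1;-2)`, neutral, hence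
normalisation-free). `betaWeight`/`betaRatio` are its continuum form in a uniformizing coordinate
(`betaRatio x = cardyFunction (crossRatio x)` is the landed `stub_betaRatioIdentity`), and
`FlatNear`/`AdmissibleRange` the flat (corner-free, mark-free) parameter ranges on which the lever law is
stated. Sources: the line card `Cruxes/RectilinearCardy/Lines/excursion-kernel-covariance.md`; Smirnov
2001 §2 (discretisation); Kozdron–Lawler arXiv:math/0501189 (excursion Poisson kernel); Cardy 1992.
-/

noncomputable section

open Set Filter Topology MeasureTheory
open Literature.Probability.RandomPlanarGeometry
open Literature.Probability.Percolation (bondDomainCrossingProb discreteCrossingProb half)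
open Literature.Probability.LatticeModels (Site meshPoint meshDomain meshBoundary discreteArc
  meshDomain_finite dirichletGreen)

namespace Summit.CriticalPhenomena.CardyFormulaZ2.Cruxes.RectilinearCardy.ExcursionKernelCovariance

/-! ### The objects of the line (all over tree declarations) -/

/-- The boundary of `R` is FLAT near `z` at radius `r`: every frontier point within `r` of `z` lies on
the horizontal, or every one on the vertical, line through `z` (the non-corner condition of the route's
crux 2 `BoundaryDefectGaussianR`, verbatim). [folklore] -/
def FlatNear (R : ConformalRectangle) (z : ℂ) (r : ℝ) : Prop :=
  (∀ z' ∈ frontier R.carrier, dist z' z < r → z'.im = z.im) ∨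
    (∀ z' ∈ frontier R.carrier, dist z' z < r → z'.re = z.re)

/-- An ADMISSIBLE parameter range `[σ, σ']`: strictly inside `(mark 1, mark 3)` (so its image on the arc
`(b → c → d)` stays away from the charged marks `b = pt 1`, `d = pt 3`; the mark `c = pt 2` is allowed,
it carries no charge for the `d`-most point) and uniformly flat (no corner in or near the image). [folklore] -/
def AdmissibleRange (R : ConformalRectangle) (σ σ' : ℝ) : Prop :=
  R.mark 1 < σ ∧ σ ≤ σ' ∧ σ' < R.mark 3 ∧ ∃ r : ℝ, 0 < r ∧ ∀ s ∈ Icc σ σ', FlatNear R (R.boundary s) r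

/-- The tail sub-arc `∂Ω[s, d] = boundary '' [s, mark 3]` of the arc `(b → c → d)`. [folklore] -/
def tailArc (R : ConformalRectangle) (s : ℝ) : Set ℂ :=
  R.boundary '' Icc s (R.mark 3)

/-- The TAIL CROSSING PROBABILITY `Q_δ(s) = P_{1/2}[(ab)_δ ↔ (∂Ω[s,d])_δ in Ω_δ]` (the crux's own
discretisation `discreteCrossingProb`): the tail function of the law of the `d`-most vertex of `(bd)_δ`
joined to `(ab)_δ`; non-increasing in `s`; at `s = mark 2` it is `bondDomainCrossingProb R δ`. [folklore] -/
def tailCrossingProb (R : ConformalRectangle) (δ s : ℝ) : ℝ :=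
  discreteCrossingProb half R.carrier δ (R.arc 0) (tailArc R s)

/-- The vertex set of the discrete domain `Ω_δ` as a `Finset` (empty junk for `δ ≤ 0`). [folklore] -/
def domainFinset (R : ConformalRectangle) (δ : ℝ) : Finset (Site 2) :=
  if h : 0 < δ then (meshDomain_finite (Ω := R.carrier) R.isBounded h).toFinset else ∅

/-- The EXCURSION KERNEL of the lattice polygon between two of its vertices: the Green function of
simple random walk killed on leaving `Ω_δ` (tree `dirichletGreen`; at inner boundary vertices of a flat
side it is `4 ×` Kozdron–Lawler's excursion Poisson kernel `h_∂A` of the outer neighbours). [cite: KozdronLawler2005, Thm 1.1] -/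
def excursionKernel (R : ConformalRectangle) (δ : ℝ) (u v : Site 2) : ℝ :=
  dirichletGreen (domainFinset R δ) u v

/-- Lattice representative of the mark `pt i`: a discrete-boundary vertex whose mesh point is nearest
to `pt i` (Hilbert `ε`; any nearest vertex works — its Kozdron–Lawler local factor is common to all
weights and cancels under self-normalisation; junk when `meshBoundary` is empty). [folklore] -/
def markRep (R : ConformalRectangle) (δ : ℝ) (i : Fin 4) : Site 2 :=
  Classical.epsilon fun x : Site 2 => x ∈ meshBoundary R.carrier δ ∧
    ∀ y ∈ meshBoundary R.carrier δ, dist (meshPoint δ x) (R.pt i) ≤ dist (meshPoint δ y) (R.pt i)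

/-- THE CUBE-ROOT WEIGHT `W(v) = (K_δ(v,a_δ) K_δ(v,b_δ) K_δ(v,d_δ))^{1/3}` — the `(1,1,1;3)` member of
the route's leg family read against the polygon's own excursion kernel, self-normalisable: marks
`a = pt 0`, `b = pt 1`, `d = pt 3` (sources, Kac weight `h(1) = 0`), moving point `v` (sink, charge
`-2`, weight `h(-2) = 1`). [folklore] -/
def cubeRootWeight (R : ConformalRectangle) (δ : ℝ) (v : Site 2) : ℝ :=
  (excursionKernel R δ v (markRep R δ 0) * excursionKernel R δ v (markRep R δ 1) *
      excursionKernel R δ v (markRep R δ 3)) ^ (1 / 3 : ℝ)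

/-- `W`-mass of the discrete tail arc `(∂Ω[s,d])_δ`. [folklore] -/
def kernelMass (R : ConformalRectangle) (δ s : ℝ) : ℝ :=
  ∑ᶠ v ∈ discreteArc R.carrier δ (tailArc R s), cubeRootWeight R δ v

/-- THE RANDOM-WALK TAIL FRACTION `ν_δ(s)`: `W`-mass of `(∂Ω[s,d])_δ` over the `W`-mass of the whole
discrete arc `(b → d)_δ` — the predicted tail function of the `d`-most joined vertex. [folklore] -/
def kernelTailFraction (R : ConformalRectangle) (δ s : ℝ) : ℝ :=
  kernelMass R δ s / kernelMass R δ (R.mark 1)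

/-- Continuum weight in a uniformizing coordinate: `ω_x(t) = |(t - x₀)(t - x₁)(t - x₃)|^{-2/3}`
(the half-plane form of `(H_ta H_tb H_td)^{1/3}`, `H_ℍ(u,v) = 1/(π(u-v)²)`, constants dropped). [folklore] -/
def betaWeight (x : Fin 4 → ℝ) (t : ℝ) : ℝ :=
  |(t - x 0) * (t - x 1) * (t - x 3)| ^ (-(2 / 3 : ℝ))

/-- THE BETA RATIO `∫_{x₂}^{x₃} ω_x / ∫_{x₁}^{x₃} ω_x` (interval integrals; for an antitone datum both
integrals change sign together). [folklore] -/
def betaRatio (x : Fin 4 → ℝ) : ℝ :=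
  (∫ t in x 2..x 3, betaWeight x t) / (∫ t in x 1..x 3, betaWeight x t)

/-! ### Proved bookkeeping -/

/-- The arc `(cd) = arc 2` is the tail arc from `mark 2`. [folklore] -/
theorem arc_two_eq_tailArc (R : ConformalRectangle) : R.arc 2 = tailArc R (R.mark 2) := by
  unfold MarkedDomain.arc tailArc
  rw [R.nextMark_two]

/-- **The evaluation point of the line is the crux's own quantity**:
`Q_δ(mark 2) = bondDomainCrossingProb R δ`, definitionally up to `nextMark 2 = mark 3`. [folklore] -/
theorem tailCrossingProb_mark_two (R : ConformalRectangle) (δ : ℝ) :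
    tailCrossingProb R δ (R.mark 2) = bondDomainCrossingProb R δ := by
  unfold tailCrossingProb bondDomainCrossingProb
  rw [arc_two_eq_tailArc]

/-- `mark 2 ∈ [mark 1, mark 3]`. [folklore] -/
theorem mark_two_mem_Icc (R : ConformalRectangle) : R.mark 2 ∈ Icc (R.mark 1) (R.mark 3) :=
  ⟨(R.strictMono_mark (show (1 : Fin 4) < 2 by decide)).le,
    (R.strictMono_mark (show (2 : Fin 4) < 3 by decide)).le⟩

/-- The cube-root weight is non-negative (killed Green functions are). [folklore] -/
theorem cubeRootWeight_nonneg (R : ConformalRectangle) (δ : ℝ) (v : Site 2) :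
    0 ≤ cubeRootWeight R δ v := by
  unfold cubeRootWeight
  exact Real.rpow_nonneg (mul_nonneg (mul_nonneg
    (Literature.Probability.LatticeModels.dirichletGreen_nonneg (by norm_num) _ _ _)
    (Literature.Probability.LatticeModels.dirichletGreen_nonneg (by norm_num) _ _ _))
    (Literature.Probability.LatticeModels.dirichletGreen_nonneg (by norm_num) _ _ _)) _

/-- `discreteArc` is monotone in the arc, as long as the smaller arc is nonempty and the larger one
does not exhaust the frontier (`Metric.infDist` to `∅` is `0`). [folklore] -/
theorem discreteArc_mono {Ω : Set ℂ} {δ : ℝ} {A A' : Set ℂ} (hAA' : A ⊆ A') (hA : A.Nonempty)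
    (hc : (frontier Ω \ A').Nonempty) : discreteArc Ω δ A ⊆ discreteArc Ω δ A' := by
  intro x hx
  rw [Literature.Probability.LatticeModels.mem_discreteArc_iff] at hx ⊢
  refine ⟨hx.1, ?_⟩
  calc Metric.infDist (meshPoint δ x) A'
      ≤ Metric.infDist (meshPoint δ x) A := Metric.infDist_le_infDist_of_subset hAA' hA
    _ ≤ Metric.infDist (meshPoint δ x) (frontier Ω \ A) := hx.2
    _ ≤ Metric.infDist (meshPoint δ x) (frontier Ω \ A') :=
        Metric.infDist_le_infDist_of_subset (fun z hz => ⟨hz.1, fun h => hz.2 (hAA' h)⟩) hc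

/-- The marked point `a = pt 0` is not on any tail arc `∂Ω[s, d]` with `mark 1 ≤ s`
(injectivity of the boundary loop on `[0,1)`). [folklore] -/
theorem pt_zero_not_mem_tailArc (R : ConformalRectangle) {s : ℝ} (h1 : R.mark 1 ≤ s) :
    R.pt 0 ∉ tailArc R s := by
  rintro ⟨t, ht, hta⟩
  have ht0 : t ∈ Ico (0 : ℝ) 1 :=
    ⟨(R.mark_mem 1).1.trans (h1.trans ht.1), lt_of_le_of_lt ht.2 (R.mark_mem 3).2⟩
  have heq : t = R.mark 0 := R.injOn_boundary ht0 (R.mark_mem 0) hta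
  have hlt : R.mark 0 < R.mark 1 := R.strictMono_mark (show (0 : Fin 4) < 1 by decide)
  linarith [ht.1]

/-- **`Q_δ` is a tail (survival) function**: non-increasing in `s` on `[mark 1, mark 3]`
(proved: monotonicity of `discreteArc` and of the measure). [folklore] -/
theorem tailCrossingProb_antitone (R : ConformalRectangle) (δ : ℝ) {s s' : ℝ}
    (h1 : R.mark 1 ≤ s) (hss' : s ≤ s') (h3 : s' ≤ R.mark 3) :
    tailCrossingProb R δ s' ≤ tailCrossingProb R δ s := by
  unfold tailCrossingProb Literature.Probability.Percolation.discreteCrossingProb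
  refine measureReal_mono ?_ (measure_ne_top _ _)
  rintro ω ⟨x, hx, y, hy, hxy⟩
  refine ⟨x, hx, y, discreteArc_mono (image_mono (Icc_subset_Icc_left hss'))
    ⟨R.boundary s', mem_image_of_mem _ (left_mem_Icc.2 h3)⟩
    ⟨R.pt 0, R.pt_mem_frontier 0, pt_zero_not_mem_tailArc R h1⟩ hy, hxy⟩

/-- **The `W`-mass of the tail arc is non-increasing in `s`** on `[mark 1, mark 3]` (proved: `discreteArc`
is monotone, the weights are `≥ 0`, the discrete domain is finite for `δ > 0`). [folklore] -/
theorem kernelMass_antitone (R : ConformalRectangle) {δ : ℝ} (hδ : 0 < δ) {s s' : ℝ}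
    (h1 : R.mark 1 ≤ s) (hss' : s ≤ s') (h3 : s' ≤ R.mark 3) :
    kernelMass R δ s' ≤ kernelMass R δ s := by
  unfold kernelMass
  have hsub : discreteArc R.carrier δ (tailArc R s') ⊆ discreteArc R.carrier δ (tailArc R s) :=
    discreteArc_mono (image_mono (Icc_subset_Icc_left hss'))
      ⟨R.boundary s', mem_image_of_mem _ (left_mem_Icc.2 h3)⟩
      ⟨R.pt 0, R.pt_mem_frontier 0, pt_zero_not_mem_tailArc R h1⟩
  have hfin : (discreteArc R.carrier δ (tailArc R s)).Finite :=
    (meshDomain_finite R.isBounded hδ).subset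
      ((Literature.Probability.LatticeModels.discreteArc_subset_meshBoundary _ _ _).trans
        (Literature.Probability.LatticeModels.meshBoundary_subset_meshDomain _ _))
  have hfin' : (discreteArc R.carrier δ (tailArc R s')).Finite := hfin.subset hsub
  rw [finsum_mem_eq_finite_toFinset_sum _ hfin, finsum_mem_eq_finite_toFinset_sum _ hfin']
  apply Finset.sum_le_sum_of_subset_of_nonneg
  · intro v hv
    simp only [Finite.mem_toFinset] at hv ⊢
    exact hsub hv
  · intro v _ _
    exact cubeRootWeight_nonneg R δ v

end Summit.CriticalPhenomena.CardyFormulaZ2.Cruxes.RectilinearCardy.ExcursionKernelCovariance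

end
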